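import Summits.BirchSwinnertonDyer.BirchSwinnertonDyer.Theorems.ByReductionTypeAtTwoSupersingularFlatBlindTwistedOnto
import HarnessLib

/-!
# Route `ByReductionTypeAtTwo` (rung K4), crux `SupersingularRankZeroAtTwo` (item stmt-BirchSwinnertonDyer-19097), line
# `odd_blind_package` slot 5 (CDC `OddBlindPackage.FlatBlindControlCardAtTwo`), hand h3 = HT-C1:
# **EXACT TWISTED CONTROL AT EVERY LEVEL `J`** — `#(Sel♭(E/ℚ_∞)[γ+1])[2^J] = #H¹_{𝓕♭ex_J}(ℚ, E[2^J](ψ₂))` for the EXACT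
# structure `𝓕♭ex_J` (Kummer KERNEL at every place `≠ v`, infinite places included; Sprung's ♭ condition at `v`)
# (cell `bsd-2adic`, seat `t42` GEN 39; LEAD ss-1 GEN 20 `HOME/ss/gen20/HAND-TARGETS-CDC.md` §2 h3, pen SUMMON 20260831T060103Z,
# director-bsd (754)(2))

HONEST FRAMING: THEOREMS ONLY (no definition, no named fact, no `sorry`, no instance); both directions of BRICK 1
(`…FlatBlindTwistedInfRes`) / the onto-ness (`…FlatBlindTwistedOnto`) with the EXACT local dictionary, packaged as a
bijection and a `Nat.card` identity; a helper (`--supports stmt-BirchSwinnertonDyer-19097`): it does NOT prove CDC, CDF_glob,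
CDF± or the crux; nothing booked; BSD is proved for no curve by any of this. bears_on: K4 (19097).

## What is proved

§1 (any number field `K : Type`, any prime `p`, any unit twist `χ_u`, ANY `ℤ_p`-extension `κ` — no cyclotomic hypothesis, no
`S₀`, no reduction hypothesis). **The exact local dictionary.**
* `twistedTorsionToH1_mem_selmerInfty_iff`: `c′ = twistedTorsionToH1 x ∈ Sel_{p^∞}(E/K_∞)` iff the level-`K` localisation of
  `x` lies in the Kummer KERNEL `ker twistedTorsionToLocalH1` at EVERY finite place and EVERY infinite place (square
  `localResOver_twistedTorsionToH1`; the «every conjugate place» clauses by `conjH1_twistedTorsionToH1_mem`).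
* `twistedTorsionToH1_mem_sharpFlatSelmerInfty_iff_mem_selmerGroup`: with Sprung's datum `(E((K_∞)_w), Ker Col^•)` at the
  distinguished place `v`, `c′ ∈ Sel^•(E/K_∞) = sharpFlatSelmerInfty W κ (closureEmb K_v) ap g c •` (Def. 7.11) iff `x` lies in
  the level-`K` Selmer group of the EXACT structure `𝓕^•ex_J`: `ker twistedTorsionToLocalH1` at every infinite place, the
  ♯/♭ family `twistedSharpFlatLocalFamily … v` (Sprung's condition at `v`, the Kummer kernel at every other finite place) on the
  finite places (the •-condition by the (D) bridge `twistedTorsionToH1_mem_sharpFlatLocalKummerOverOfEmb_iff`).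

§2 (`u = −1`, any `K`, `p`, `κ` with topological generator `γ`, `E(K)[p] = 0`). ★ `exists_bijective_selmerGroup_to_torsionBy_endInvariants`:
`x ↦ c′` is a BIJECTION `H¹_{𝓕^•ex_J}(K, E[p^J](χ_{−1})) → (Sel^•(E/K_∞)[γ+1])[p^J]` — into by §1 + `conj_γ c′ = −c′` + `p^J c′ = 0`,
one-to-one by `TwistRestrict.twistedTorsionToH1_injective`, onto by `exists_twistedTorsionToH1_eq_of_zsmul_conjH1_eq` + §1 read
backwards; hence `natCard_torsionBy_endInvariants_eq_natCard_selmerGroup`.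

§3 (`K = ℚ`, `p = 2`, `ψ₂ = χ_{−1}`, `GoodSS W 2`). ★ `HTC1_natCard_torsionBy_endInvariants_eq_natCard_selmerGroup` — the hand
h3 VERBATIM (`E(ℚ)[2] = 0` from `GoodSS W 2`; the binders `hκ`, `hv`, `[W.IsGloballyMinimal]` are carried for the hand's
signature only).

USAGE NOTE. In §1–§2 the exact structure is a PARAMETER `𝓕 : SelmerStructure _` with the two pointwise equations `hinl`/`hinr`
(rather than the `fun pl ↦ match pl with …` literal of the hand): a `match` literal elaborates to an auxiliary matcher constant
of the declaring module, and two such literals unify by `exact` only when their matchers have the same parameters (e.g. both over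
`ℚ`; a `K`-generic literal specialised to `ℚ` does NOT unify with a `ℚ`-literal by plain `exact`). So: to consume the count for a
structure spelled as your own `match` literal, apply `natCard_torsionBy_endInvariants_eq_natCard_selmerGroup … 𝓕 (fun _ ↦ rfl)
(fun _ ↦ rfl) …` (as §3 does); the hand `HTC1_…` itself is stated with the LEAD's `ℚ`-literal and closes a verbatim restatement
over `ℚ` by `exact`.

References: [GreenbergLNM1716] §4 pp. 107, 122–124 («`H¹(F_Σ/F, A_s) → H¹(F_Σ/F_∞, A_s)^Γ`», `A_s = E[p^∞] ⊗ κ^s`);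
[Sprung2012] Def. 7.9, Def. 7.11 (p. 1503); [SerreGaloisCohomology1997] I §2.6 (b).
-/

set_option autoImplicit false
set_option linter.dupNamespace false

noncomputable section

open scoped Classical NumberField AddSubgroup

namespace Summit.BirchSwinnertonDyer.BirchSwinnertonDyer.Theorems

namespace OddBlindTwist

open NumberField IsDedekindDomain Field WeierstrassCurve Literature.NumberTheory.EllipticCurves
  Literature.NumberTheory.EllipticCurves.IwasawaDual Literature.NumberTheory.GaloisRepresentations
  Literature.NumberTheory.GaloisCohomology ZpExtension Literature.NumberTheory.EllipticCurves.Kobayashi2003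
  Literature.NumberTheory.EllipticCurves.Sprung2017 Literature.NumberTheory.EllipticCurves.Sprung2012
  Literature.NumberTheory.EllipticCurves.Rank1Residual
open Literature.NumberTheory.GaloisRepresentations.DiscreteGaloisModule (SelmerStructure)

/-! ## §1 The exact local dictionary (any `K`, `p`, `u`, `κ`) -/

section Dictionary

variable {K : Type} [Field K] [NumberField K] (W : WeierstrassCurve K) (p : ℕ) [Fact p.Prime]
  (κ : ZpExtension K p) (J : ℕ) (u : ℤ) (hu : (p : ℤ) ∣ u - 1)

/-- **`c′ = twistedTorsionToH1 x ∈ Sel_{p^∞}(E/K_∞)` iff `x` is in the Kummer KERNEL at every place of `K`** (finite and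
infinite): the local restriction over `K_∞` of `c′` at the chosen place above `v` is `twistedTorsionToLocalH1 (loc_v x)`
(`localResOver_twistedTorsionToH1`), and the conditions at the conjugate places follow because `c′` is an eigenclass of every
`conj_σ` (`conjH1_twistedTorsionToH1_mem`). No hypothesis on `κ` (cyclotomic or not), on `u`, or on the reduction of `E`.
[cite: GreenbergLNM1716, §4 pp. 122–124] -/
theorem twistedTorsionToH1_mem_selmerInfty_iff (x : galoisCohomology (W.twistedTorsionGaloisModule p κ J u hu) 1) :
    W.twistedTorsionToH1 p κ J u hu x ∈ W.selmerInfty κ ↔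
      (∀ v : HeightOneSpectrum (𝓞 K),
          galoisCohomology.res (W.twistedTorsionGaloisModule p κ J u hu) (v.adicCompletion K) 1 x ∈
            (W.twistedTorsionToLocalH1 p κ J u hu (v.adicCompletion K)).ker) ∧
        ∀ w : InfinitePlace K,
          galoisCohomology.res (W.twistedTorsionGaloisModule p κ J u hu) w.Completion 1 x ∈
            (W.twistedTorsionToLocalH1 p κ J u hu w.Completion).ker := by
  have hone : W.conjH1 p κ.kerSubgroup 1 = AddMonoidHom.id _ := W.conjH1_one_holds p κ.kerSubgroup
  constructor
  · intro hx
    have hsel := (W.mem_selmerGroupOver_iff p κ.kerSubgroup _).1 hx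
    refine ⟨fun v ↦ ?_, fun w ↦ ?_⟩
    · have h := hsel.1 v 1
      rw [hone, AddMonoidHom.id_apply, WeierstrassCurve.mem_localKerOver_iff, localResOver_twistedTorsionToH1] at h
      exact h
    · have h := hsel.2 w 1
      rw [hone, AddMonoidHom.id_apply, WeierstrassCurve.mem_localKerOver_iff, localResOver_twistedTorsionToH1] at h
      exact h
  · rintro ⟨hfin, hinf⟩
    show W.twistedTorsionToH1 p κ J u hu x ∈ W.selmerGroupOver p κ.kerSubgroup
    rw [W.mem_selmerGroupOver_iff p κ.kerSubgroup]
    refine ⟨fun v σ ↦ W.conjH1_twistedTorsionToH1_mem p κ J u hu _ x ?_ σ,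
      fun w σ ↦ W.conjH1_twistedTorsionToH1_mem p κ J u hu _ x ?_ σ⟩
    · rw [WeierstrassCurve.mem_localKerOver_iff, localResOver_twistedTorsionToH1]
      exact hfin v
    · rw [WeierstrassCurve.mem_localKerOver_iff, localResOver_twistedTorsionToH1]
      exact hinf w

variable (v : HeightOneSpectrum (𝓞 K)) (ap : ℤ) (g : absoluteGaloisGroup (v.adicCompletion K))
  (c : ℕ → localPoints W (v.adicCompletion K)) (col : Chroma)

/-- **`c′ ∈ Sel^•(E/K_∞)` iff `x ∈ H¹_{𝓕^•ex_J}(K, E[p^J](χ_u))` — the EXACT structure.** For Sprung's datum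
`(M, 𝒦) = (E((K_∞)_w), Ker Col^•(ap, g, c))` at the distinguished place `v` (Def. 7.9 / 7.11) and ANY Selmer structure `𝓕` on
`E[p^J](χ_u)` which is, place by place, the EXACT one — the Kummer KERNEL `ker twistedTorsionToLocalH1` at every infinite place
(`hinl`) and the ♯/♭ family `twistedSharpFlatLocalFamily … v M 𝒦` on the finite places (`hinr`: Sprung's annihilator condition at
`v`, the Kummer kernel at every other finite place) — the twisted restriction `c′ = twistedTorsionToH1 x` lies in
`sharpFlatSelmerInfty W κ (closureEmb K_v) ap g c •` iff `x ∈ H¹_𝓕(K, E[p^J](χ_u))` (the •-condition by the (D) bridge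
`twistedTorsionToH1_mem_sharpFlatLocalKummerOverOfEmb_iff`, the rest by `twistedTorsionToH1_mem_selmerInfty_iff`). No `S₀`, no
unramified condition, no hypothesis on `κ`: this is the structure for which control is EXACT. (`𝓕` is a parameter with
pointwise equations so that the lemma applies to any spelling of the structure, e.g. a `fun pl ↦ match pl with …` literal, by `rfl`.)
[cite: Sprung2012, Def. 7.9 and Def. 7.11 (p. 1503)] [cite: GreenbergLNM1716, §4 pp. 122–124] -/
theorem twistedTorsionToH1_mem_sharpFlatSelmerInfty_iff_mem_selmerGroup
    (𝓕 : SelmerStructure (W.twistedTorsionGaloisModule p κ J u hu))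
    (hinl : ∀ w : InfinitePlace K, 𝓕 (Sum.inl w) = (W.twistedTorsionToLocalH1 p κ J u hu w.Completion).ker)
    (hinr : ∀ v' : HeightOneSpectrum (𝓞 K), 𝓕 (Sum.inr v') = W.twistedSharpFlatLocalFamily p κ J u hu v
      (localTowerPointsOfEmb κ (closureEmb (K := K) (v.adicCompletion K)) W)
      (colemanKer κ (closureEmb (K := K) (v.adicCompletion K)) W ap g c col) v')
    (x : galoisCohomology (W.twistedTorsionGaloisModule p κ J u hu) 1) :
    W.twistedTorsionToH1 p κ J u hu x ∈
        sharpFlatSelmerInfty W κ (closureEmb (K := K) (v.adicCompletion K)) ap g c col ↔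
      x ∈ 𝓕.selmerGroup := by
  rw [SelmerStructure.mem_selmerGroup_iff]
  constructor
  · intro hx
    have hx' := (mem_sharpFlatSelmerInfty_iff W κ _ ap g c col _).1 hx
    have hker := (twistedTorsionToH1_mem_selmerInfty_iff W p κ J u hu x).1 hx'.1
    have hone : W.conjH1 p κ.kerSubgroup 1 = AddMonoidHom.id _ := W.conjH1_one_holds p κ.kerSubgroup
    have hflat := hx'.2 1
    rw [hone, AddMonoidHom.id_apply, twistedTorsionToH1_mem_sharpFlatLocalKummerOverOfEmb_iff] at hflat
    intro pl
    rcases pl with w | v'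
    · rw [hinl w]
      exact hker.2 w
    · rw [hinr v']
      change galoisCohomology.res (W.twistedTorsionGaloisModule p κ J u hu) (v'.adicCompletion K) 1 x ∈
        W.twistedSharpFlatLocalFamily p κ J u hu v
          (localTowerPointsOfEmb κ (closureEmb (K := K) (v.adicCompletion K)) W)
          (colemanKer κ (closureEmb (K := K) (v.adicCompletion K)) W ap g c col) v'
      by_cases hvv : v' = v
      · rw [hvv, twistedSharpFlatLocalFamily_self]
        exact hflat
      · rw [W.twistedSharpFlatLocalFamily_of_ne p κ J u hu v _ _ hvv]
        exact hker.1 v'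
  · intro hx
    have hfin' : ∀ v' : HeightOneSpectrum (𝓞 K),
        galoisCohomology.res (W.twistedTorsionGaloisModule p κ J u hu) (v'.adicCompletion K) 1 x ∈
          W.twistedSharpFlatLocalFamily p κ J u hu v
            (localTowerPointsOfEmb κ (closureEmb (K := K) (v.adicCompletion K)) W)
            (colemanKer κ (closureEmb (K := K) (v.adicCompletion K)) W ap g c col) v' := fun v' ↦ by
      have h := hx (Sum.inr v')
      rw [hinr v'] at h
      exact h
    have hfin : ∀ v' : HeightOneSpectrum (𝓞 K),
        galoisCohomology.res (W.twistedTorsionGaloisModule p κ J u hu) (v'.adicCompletion K) 1 x ∈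
          (W.twistedTorsionToLocalH1 p κ J u hu (v'.adicCompletion K)).ker := fun v' ↦
      W.twistedSharpFlatLocalFamily_le_ker p κ J u hu v _ _ v' (hfin' v')
    have hinf : ∀ w : InfinitePlace K,
        galoisCohomology.res (W.twistedTorsionGaloisModule p κ J u hu) w.Completion 1 x ∈
          (W.twistedTorsionToLocalH1 p κ J u hu w.Completion).ker := fun w ↦ by
      have h := hx (Sum.inl w)
      rw [hinl w] at h
      exact h
    have hflat : galoisCohomology.res (W.twistedTorsionGaloisModule p κ J u hu) (v.adicCompletion K) 1 x ∈
        W.twistedSharpFlatLocalKummer p κ J u hu (v.adicCompletion K)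
          (localTowerPointsOfEmb κ (closureEmb (K := K) (v.adicCompletion K)) W)
          (colemanKer κ (closureEmb (K := K) (v.adicCompletion K)) W ap g c col) := by
      have h := hfin' v
      rwa [twistedSharpFlatLocalFamily_self] at h
    exact W.twistedTorsionToH1_mem_sharpFlatSelmerInfty p κ J u hu ap g c col x
      ((twistedTorsionToH1_mem_selmerInfty_iff W p κ J u hu x).2 ⟨hfin, hinf⟩) hflat

end Dictionary

/-! ## §2 `u = −1`: the bijection `H¹_{𝓕^•ex_J}(K, E[p^J](χ_{−1})) ≃ (Sel^•(E/K_∞)[γ+1])[p^J]` and the count -/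

section Bijection

variable {K : Type} [Field K] [NumberField K] (W : WeierstrassCurve K) [W.IsElliptic] (p : ℕ) [Fact p.Prime]
  (κ : ZpExtension K p) (J : ℕ) (v : HeightOneSpectrum (𝓞 K)) (ap : ℤ) (g : absoluteGaloisGroup (v.adicCompletion K))
  (c : ℕ → localPoints W (v.adicCompletion K)) (col : Chroma) (hu1 : (p : ℤ) ∣ (-1 : ℤ) - 1)
  (𝓕 : SelmerStructure (W.twistedTorsionGaloisModule p κ J (-1) hu1))

/-- ★ **EXACT TWISTED CONTROL as a bijection (`u = −1`, any number field `K`, any `p`, any `ℤ_p`-extension `κ` with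
topological generator `γ`, `E(K)[p] = 0`).** For a Selmer structure `𝓕` on `E[p^J](χ_{−1})` which is place by place the EXACT one
(`hinl`: Kummer kernel at every infinite place; `hinr`: the ♯/♭ family — Sprung's condition at `v`, the Kummer kernel at every other
finite place), the map `x ↦ c′ = twistedTorsionToH1 x` is a BIJECTION from `H¹_𝓕(K, E[p^J](χ_{−1}))` onto the `p^J`-torsion of
`Sel^•(E/K_∞)[γ+1] = endInvariants (conjSharpFlatSelmerInfty … γ + 1)`: INTO by the dictionary
`twistedTorsionToH1_mem_sharpFlatSelmerInfty_iff_mem_selmerGroup`, `conj_γ c′ = −c′` (`conjH1_twistedTorsionToH1_eq_neg`) and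
`p^J c′ = 0`; ONE-TO-ONE since `E(K)[p] = 0` (`TwistRestrict.twistedTorsionToH1_injective`); ONTO by the onto-ness of the twisted
inflation–restriction (`exists_twistedTorsionToH1_eq_of_zsmul_conjH1_eq`, `E(K_∞)[p^∞] = 0` by
`fixedPoints_kerSubgroup_geomPrimaryTorsion_eq_bot`) and the dictionary read backwards. Greenberg: «`H¹(F_Σ/F, A_s) →
H¹(F_Σ/F_∞, A_s)^Γ` is surjective … with finite kernel» made EXACT at finite level by the exact local conditions.
[cite: GreenbergLNM1716, §4 pp. 107, 122–124] [cite: Sprung2012, Def. 7.11 (p. 1503)] [cite: SerreGaloisCohomology1997, I §2.6 (b)] -/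
theorem exists_bijective_selmerGroup_to_torsionBy_endInvariants
    (hinl : ∀ w : InfinitePlace K, 𝓕 (Sum.inl w) = (W.twistedTorsionToLocalH1 p κ J (-1) hu1 w.Completion).ker)
    (hinr : ∀ v' : HeightOneSpectrum (𝓞 K), 𝓕 (Sum.inr v') = W.twistedSharpFlatLocalFamily p κ J (-1) hu1 v
      (localTowerPointsOfEmb κ (closureEmb (K := K) (v.adicCompletion K)) W)
      (colemanKer κ (closureEmb (K := K) (v.adicCompletion K)) W ap g c col) v')
    (hK : ∀ P : W.toAffine.Point, p • P = 0 → P = 0) {γ : absoluteGaloisGroup K} (hγ : κ.IsTopGenerator γ) :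
    ∃ Φ : 𝓕.selmerGroup →
        (endInvariants
          (conjSharpFlatSelmerInfty W κ (closureEmb (K := K) (v.adicCompletion K)) ap g c col γ + 1))[((p ^ J : ℕ) : ℤ)],
      Function.Bijective Φ ∧
        ∀ x, ((((Φ x : endInvariants (conjSharpFlatSelmerInfty W κ (closureEmb (K := K) (v.adicCompletion K))
            ap g c col γ + 1)) : sharpFlatSelmerInfty W κ (closureEmb (K := K) (v.adicCompletion K)) ap g c col) :
              W.subgroupH1 p κ.kerSubgroup)) = W.twistedTorsionToH1 p κ J (-1) hu1 x := by
  have hfix := W.fixedPoints_kerSubgroup_geomPrimaryTorsion_eq_bot κ hK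
  have hinj := SignedEC.TwistRestrict.twistedTorsionToH1_injective W p κ J (-1) hu1 hK
  -- INTO: `c′ ∈ Sel^•`, `conj_γ c′ = −c′`, `p^J c′ = 0`
  have hmem : ∀ x : 𝓕.selmerGroup, W.twistedTorsionToH1 p κ J (-1) hu1 x ∈
      sharpFlatSelmerInfty W κ (closureEmb (K := K) (v.adicCompletion K)) ap g c col := fun x ↦
    (twistedTorsionToH1_mem_sharpFlatSelmerInfty_iff_mem_selmerGroup W p κ J (-1) hu1 v ap g c col 𝓕 hinl hinr x).2 x.2
  have hend : ∀ x : 𝓕.selmerGroup,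
      (⟨W.twistedTorsionToH1 p κ J (-1) hu1 x, hmem x⟩ :
          sharpFlatSelmerInfty W κ (closureEmb (K := K) (v.adicCompletion K)) ap g c col) ∈
        endInvariants (conjSharpFlatSelmerInfty W κ (closureEmb (K := K) (v.adicCompletion K)) ap g c col γ + 1) :=
    fun x ↦ by
    rw [mem_endInvariants_iff]
    apply Subtype.ext
    change W.conjH1 p κ.kerSubgroup γ (W.twistedTorsionToH1 p κ J (-1) hu1 x) + W.twistedTorsionToH1 p κ J (-1) hu1 x = 0
    rw [conjH1_twistedTorsionToH1_eq_neg W p κ J hu1 hγ x, neg_add_cancel]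
  have htor : ∀ x : 𝓕.selmerGroup,
      (⟨⟨W.twistedTorsionToH1 p κ J (-1) hu1 x, hmem x⟩, hend x⟩ :
          endInvariants (conjSharpFlatSelmerInfty W κ (closureEmb (K := K) (v.adicCompletion K)) ap g c col γ + 1)) ∈
        (endInvariants
          (conjSharpFlatSelmerInfty W κ (closureEmb (K := K) (v.adicCompletion K)) ap g c col γ + 1))[((p ^ J : ℕ) : ℤ)] :=
    fun x ↦ by
    rw [AddSubgroup.torsionBy.nsmul_iff]
    apply Subtype.ext
    apply Subtype.ext
    rw [AddSubgroupClass.coe_nsmul, AddSubgroupClass.coe_nsmul, ZeroMemClass.coe_zero, ZeroMemClass.coe_zero]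
    exact pow_smul_twistedTorsionToH1_eq_zero W p κ J (-1) hu1 x
  refine ⟨fun x ↦ ⟨⟨⟨W.twistedTorsionToH1 p κ J (-1) hu1 x, hmem x⟩, hend x⟩, htor x⟩,
    ⟨fun x y hxy ↦ ?_, fun t ↦ ?_⟩, fun x ↦ rfl⟩
  · -- ONE-TO-ONE
    have h := congrArg (fun t : (endInvariants (conjSharpFlatSelmerInfty W κ (closureEmb (K := K) (v.adicCompletion K))
        ap g c col γ + 1))[((p ^ J : ℕ) : ℤ)] ↦ ((((t : endInvariants (conjSharpFlatSelmerInfty W κ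
          (closureEmb (K := K) (v.adicCompletion K)) ap g c col γ + 1)) : sharpFlatSelmerInfty W κ
            (closureEmb (K := K) (v.adicCompletion K)) ap g c col) : W.subgroupH1 p κ.kerSubgroup))) hxy
    exact Subtype.ext (hinj h)
  · -- ONTO: the class `s` underlying `t`, killed by `p^J`, with `(−1) · conj_γ s = s`
    have hsJ : p ^ J • (((t : endInvariants (conjSharpFlatSelmerInfty W κ (closureEmb (K := K) (v.adicCompletion K))
        ap g c col γ + 1)) : sharpFlatSelmerInfty W κ (closureEmb (K := K) (v.adicCompletion K)) ap g c col) :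
          W.subgroupH1 p κ.kerSubgroup) = 0 := by
      have h := AddSubgroup.torsionBy.nsmul t
      have h' := congrArg (fun y : (endInvariants (conjSharpFlatSelmerInfty W κ (closureEmb (K := K) (v.adicCompletion K))
          ap g c col γ + 1))[((p ^ J : ℕ) : ℤ)] ↦ (((y : endInvariants (conjSharpFlatSelmerInfty W κ
            (closureEmb (K := K) (v.adicCompletion K)) ap g c col γ + 1)) : sharpFlatSelmerInfty W κ
              (closureEmb (K := K) (v.adicCompletion K)) ap g c col) : W.subgroupH1 p κ.kerSubgroup)) h
      simpa only [AddSubgroupClass.coe_nsmul, ZeroMemClass.coe_zero] using h'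
    have hsγ : (-1 : ℤ) • W.conjH1 p κ.kerSubgroup γ (((t : endInvariants (conjSharpFlatSelmerInfty W κ
        (closureEmb (K := K) (v.adicCompletion K)) ap g c col γ + 1)) :
          sharpFlatSelmerInfty W κ (closureEmb (K := K) (v.adicCompletion K)) ap g c col) :
            W.subgroupH1 p κ.kerSubgroup) =
        (((t : endInvariants (conjSharpFlatSelmerInfty W κ (closureEmb (K := K) (v.adicCompletion K))
          ap g c col γ + 1)) : sharpFlatSelmerInfty W κ (closureEmb (K := K) (v.adicCompletion K)) ap g c col) :
            W.subgroupH1 p κ.kerSubgroup) := by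
      have h := (mem_endInvariants_iff _ _).1 (t : endInvariants (conjSharpFlatSelmerInfty W κ
        (closureEmb (K := K) (v.adicCompletion K)) ap g c col γ + 1)).2
      have h' := congrArg (fun y : sharpFlatSelmerInfty W κ (closureEmb (K := K) (v.adicCompletion K)) ap g c col ↦
        (y : W.subgroupH1 p κ.kerSubgroup)) h
      change W.conjH1 p κ.kerSubgroup γ _ + _ = (0 : W.subgroupH1 p κ.kerSubgroup) at h'
      rw [neg_one_zsmul, neg_eq_iff_eq_neg]
      exact eq_neg_of_add_eq_zero_left h'
    obtain ⟨x, hx⟩ := exists_twistedTorsionToH1_eq_of_zsmul_conjH1_eq W p κ J (-1) hu1 hfix hγ _ hsJ hsγ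
    have hxmem : x ∈ 𝓕.selmerGroup :=
      (twistedTorsionToH1_mem_sharpFlatSelmerInfty_iff_mem_selmerGroup W p κ J (-1) hu1 v ap g c col 𝓕 hinl hinr x).1
        (by rw [hx]; exact ((t : endInvariants (conjSharpFlatSelmerInfty W κ (closureEmb (K := K) (v.adicCompletion K))
          ap g c col γ + 1)) : sharpFlatSelmerInfty W κ (closureEmb (K := K) (v.adicCompletion K)) ap g c col).2)
    exact ⟨⟨x, hxmem⟩, Subtype.ext (Subtype.ext (Subtype.ext hx))⟩

/-- **EXACT TWISTED CONTROL, counting form (`u = −1`, any `K`, `p`, `κ`, `γ`, `E(K)[p] = 0`):**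
`#(Sel^•(E/K_∞)[γ+1])[p^J] = #H¹_𝓕(K, E[p^J](χ_{−1}))` for any structure `𝓕` that is place by place the EXACT one (`Nat.card` of
both sides of the bijection `exists_bijective_selmerGroup_to_torsionBy_endInvariants`; both sides `0` if infinite). To consume it with
a structure spelled as a `fun pl ↦ match pl with | Sum.inl w => … | Sum.inr v' => …` literal, pass `(fun _ ↦ rfl) (fun _ ↦ rfl)`.
[cite: GreenbergLNM1716, §4 pp. 107, 122–124] [cite: Sprung2012, Def. 7.11 (p. 1503)] -/
theorem natCard_torsionBy_endInvariants_eq_natCard_selmerGroup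
    (hinl : ∀ w : InfinitePlace K, 𝓕 (Sum.inl w) = (W.twistedTorsionToLocalH1 p κ J (-1) hu1 w.Completion).ker)
    (hinr : ∀ v' : HeightOneSpectrum (𝓞 K), 𝓕 (Sum.inr v') = W.twistedSharpFlatLocalFamily p κ J (-1) hu1 v
      (localTowerPointsOfEmb κ (closureEmb (K := K) (v.adicCompletion K)) W)
      (colemanKer κ (closureEmb (K := K) (v.adicCompletion K)) W ap g c col) v')
    (hK : ∀ P : W.toAffine.Point, p • P = 0 → P = 0) {γ : absoluteGaloisGroup K} (hγ : κ.IsTopGenerator γ) :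
    Nat.card ((endInvariants
      (conjSharpFlatSelmerInfty W κ (closureEmb (K := K) (v.adicCompletion K)) ap g c col γ + 1))[((p ^ J : ℕ) : ℤ)]) =
    Nat.card 𝓕.selmerGroup := by
  obtain ⟨Φ, hΦ, -⟩ :=
    exists_bijective_selmerGroup_to_torsionBy_endInvariants W p κ J v ap g c col hu1 𝓕 hinl hinr hK hγ
  exact (Nat.card_congr (Equiv.ofBijective Φ hΦ)).symm

end Bijection

/-! ## §3 The ss line at `p = 2`, `ψ₂ = χ_{−1}`: HT-C1 (hand h3 of LEAD ss-1 GEN 20, signature verbatim) -/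

section Two

/-- ★ **HT-C1 = h3 (EXACT TWISTED CONTROL, every level `J`)** — hand h3 of LEAD ss-1 GEN 20 (`HOME/ss/gen20/HAND-TARGETS-CDC.md` §2),
signature VERBATIM. For `W/ℚ` with `GoodSS W 2`, the cyclotomic `κ` with topological generator `γ`, `v ∋ 2`, Sprung's local data
`(a₂ = W.frobeniusTrace 2, g, c)`, colour ♭: the `2^J`-torsion of `T = Sel♭(E/ℚ_∞)[γ+1] = endInvariants (conjSharpFlatSelmerInfty … .flat γ + 1)`
has EXACTLY as many elements as the level-`ℚ` Selmer group of `E[2^J](ψ₂)` for the EXACT structure `𝓕♭ex_J`: the Kummer KERNEL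
`ker twistedTorsionToLocalH1` at every place other than `v` — infinite places included — and Sprung's ♭ condition at `v`
(`twistedSharpFlatLocalFamily … v` on the finite places). Proof: `natCard_torsionBy_endInvariants_eq_natCard_selmerGroup` for the
structure literal (pointwise `rfl`) with `E(ℚ)[2] = 0` from `GoodSS W 2` (`SignedTransportAtTwo.eq_zero_of_two_nsmul_eq_zero_of_goodSS`).
The binders `hκ`, `hv` and `[W.IsGloballyMinimal]` are carried for the hand's signature only (the identity holds for any
`ℤ₂`-extension `κ` and any distinguished `v`). HONEST FRAMING: a helper (`--supports` 19097); it does not prove CDC, CDF_glob, CDF±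
or the crux; 19097 stays OPEN; BSD is proved for no curve. [cite: GreenbergLNM1716, §4 pp. 107, 122–124]
[cite: Sprung2012, Def. 7.9 and Def. 7.11 (p. 1503)] -/
theorem HTC1_natCard_torsionBy_endInvariants_eq_natCard_selmerGroup (W : WeierstrassCurve ℚ) [W.IsElliptic] [W.IsGloballyMinimal]
    (hss : GoodSS W 2) {κ : ZpExtension ℚ 2} (hκ : κ.IsCyclotomic) {γ : absoluteGaloisGroup ℚ} (hγ : κ.IsTopGenerator γ)
    (v : HeightOneSpectrum (𝓞 ℚ)) (hv : (2 : 𝓞 ℚ) ∈ v.asIdeal)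
    (g : absoluteGaloisGroup (v.adicCompletion ℚ)) (c : ℕ → localPoints W (v.adicCompletion ℚ)) (J : ℕ) :
    Nat.card ((endInvariants (conjSharpFlatSelmerInfty W κ (closureEmb (K := ℚ) (v.adicCompletion ℚ))
      (W.frobeniusTrace 2) g c .flat γ + 1))[((2 ^ J : ℕ) : ℤ)]) =
    Nat.card (SelmerStructure.selmerGroup (ρ := W.twistedTorsionGaloisModule 2 κ J (-1) OddBlindTwist.two_dvd_neg_one_sub_one)
      (fun pl ↦ match pl with
        | Sum.inl w => (W.twistedTorsionToLocalH1 2 κ J (-1) OddBlindTwist.two_dvd_neg_one_sub_one w.Completion).ker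
        | Sum.inr v' => W.twistedSharpFlatLocalFamily 2 κ J (-1) OddBlindTwist.two_dvd_neg_one_sub_one v
            (localTowerPointsOfEmb κ (closureEmb (K := ℚ) (v.adicCompletion ℚ)) W)
            (colemanKer κ (closureEmb (K := ℚ) (v.adicCompletion ℚ)) W (W.frobeniusTrace 2) g c .flat) v')) := by
  have _hκ := hκ -- carried for the hand's signature only: the identity holds for any `ℤ₂`-extension `κ`
  have _hv := hv -- carried for the hand's signature only: the identity holds at any distinguished place `v`
  exact natCard_torsionBy_endInvariants_eq_natCard_selmerGroup W 2 κ J v (W.frobeniusTrace 2) g c .flat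
    two_dvd_neg_one_sub_one _ (fun _ ↦ rfl) (fun _ ↦ rfl)
    (fun P hP ↦ SignedTransportAtTwo.eq_zero_of_two_nsmul_eq_zero_of_goodSS W hss P (by convert hP)) hγ

end Two

end OddBlindTwist

end Summit.BirchSwinnertonDyer.BirchSwinnertonDyer.Theorems

end
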